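import Mathlib
import HarnessLib
import Literature.MathematicalPhysics.QuantumLattice.FermiRG.BGM2003SectorCountingProof
import Summits.HubbardSuperconductivity.HubbardSuperconductivity.Theorems.KLProgrammeFermiSurfaceBGM2003

/-!
# Route `KLProgramme` (cruxes K1 `H10TwoPointLimit`, K3 `KLRegimeTwoPointLimit`): BGM 2003's sector lemmata
# (App. 7.1 Lemmas 7.1–7.4, §7.3 Lemma 7.5) and the SECTOR COUNTING LEMMA 3.1 (4.3) are THEOREMS for the
# free Hubbard band on every closed shell inside `-4 < μ < 0`

Cell `gate-hubbard-kl`, seat fs-1 (g4), risk-register item r2 «Fermi-surface hypotheses on the window». The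
typer wave typed BGM 2003 (Ann. Henri Poincaré 4 (2003) 137–193) §1.2 / App. 7 / §3.1 as named `Prop` facts
over the dispersion predicate `FermiRG.BGM2003.DispersionHyp ε μ e₀ u` (`BGM2003Sectors.lean`, t3), and t3 then
DISCHARGED every one of them for a GENERAL symmetric convex dispersion: `lemma71_normalAngle_holds`,
`lemma72_sectorPolar_holds`, `lemma73_sectorBox_holds`, `lemma74_projection_holds`,
`lemma75_parallelogram_holds` (`BGM2003Sectors.lean`) and the sector counting lemma
`lemma31_sectorCounting_holds` (`BGM2003SectorCountingProof.lean`, p430224). fs-1 g0 proved that the Hubbard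
band `ε = sqDispersion` with the polar chart `u θ e = bandFermiRadius (μ + e) θ` satisfies `DispersionHyp`
on every closed shell `0 < e₀`, `-4 < μ - e₀`, `μ + e₀ < 0` (`klfs_bgm2003_dispersionHyp`,
`KLProgrammeFermiSurfaceBGM2003.lean`, p417389).

This file composes the two: for the HUBBARD BAND at intermediate filling (in particular on the certified
window `μ ∈ [-0.4267, -0.1798]`, `e₀ = 0.08`, and on the analysis window `μ ∈ [-1, -0.15]`, `e₀ = 0.07`)
BGM 2003's Lemma 7.1 (Gauss-map bi-Lipschitz on `𝕋¹`), Lemma 7.2 (polar box of an s-sector), Lemma 7.3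
(normal/tangential box + tangential derivative), Lemma 7.4 (projection), Lemma 7.5 (parallelogram lemma)
and **Lemma 3.1 (4.3): `|A_{h,h'}(ω₁; ω̃₂,…,ω̃_L)| ≤ c^L γ^{(h-h')(L-3)/2}` for every even `L ≥ 4`, `≤ c` for
`L = 2`, with momentum conservation in `ℝ²`** hold UNCONDITIONALLY — the isotropic `2n`-leg sector count
the printed single-scale bounds (BGM 2006 Thm 2.1 / (3.23), child 3 `KLRegimeEngine`, K1) consume, at the
filling the programme works at (BGM's own range is `μ < -2 - √2`). Conservation MODULO `2πℤ²` (umklapp, the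
window's corner classes) is NOT covered by Lemma 3.1 — that is the tree's `count_pairs_exists` (`L = 4`) and
p4's `lemmaA31_mod_oneDeterminedLeg` / `bgm_endpoint_count_le` (GAP-LEDGER E-038 rider: (4.3) is consumed
in `ℝ²` only). No definitions; everything PROVED by composition. [folklore]
-/

noncomputable section

open Real Set

-- the tree's namespace `Summit.<Summit>.<Problem>.Theorems` repeats the summit name by design (D-0017)
set_option linter.dupNamespace false

namespace Summit.HubbardSuperconductivity.HubbardSuperconductivity.Theorems

open Literature.MathematicalPhysics.QuantumLattice
open Literature.MathematicalPhysics.QuantumLattice.FermiRG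
open Literature.MathematicalPhysics.QuantumLattice.FermiRG.BGM2003

/-! ### §1 BGM 2003 App. 7.1 / §7.3 for the Hubbard band on a closed shell -/

section Shell

variable {μ e₀ : ℝ} (he₀ : 0 < e₀) (h₁ : -4 < μ - e₀) (h₂ : μ + e₀ < 0)
include he₀ h₁ h₂

/-- **BGM 2003 Lemma 7.1 (A1.9) for the Hubbard band**: on the shell `|ε - μ| ≤ e₀` the normal angle
`α(θ, e)` of the level curve `u_{μ+e}(θ) e⃗_r(θ)` is monotone in `θ`, bi-Lipschitz on `𝕋¹`
(`c₁‖θ₂ - θ₁‖ ≤ ‖α(θ₂,e) - α(θ₁,e)‖ ≤ c₂‖θ₂ - θ₁‖`) and `α(θ + π, e) = α(θ, e) + π`. Composition of t3's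
`lemma71_normalAngle_holds` with `klfs_bgm2003_dispersionHyp`. [folklore] -/
theorem klfs_bgm2003_lemma71_hubbard :
    ∃ c₁ c₂ : ℝ, 0 < c₁ ∧ c₁ ≤ c₂ ∧ ∀ e : ℝ, |e| ≤ e₀ →
      Monotone (fun θ => normalAngle (fun ϑ e' => bandFermiRadius (μ + e') ϑ) θ e) ∧
      (∀ θ₁ θ₂ : ℝ,
        c₁ * torusDist (θ₂ - θ₁) ≤
            torusDist (normalAngle (fun ϑ e' => bandFermiRadius (μ + e') ϑ) θ₂ e -
              normalAngle (fun ϑ e' => bandFermiRadius (μ + e') ϑ) θ₁ e) ∧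
          torusDist (normalAngle (fun ϑ e' => bandFermiRadius (μ + e') ϑ) θ₂ e -
              normalAngle (fun ϑ e' => bandFermiRadius (μ + e') ϑ) θ₁ e) ≤
            c₂ * torusDist (θ₂ - θ₁)) ∧
      ∀ θ : ℝ, normalAngle (fun ϑ e' => bandFermiRadius (μ + e') ϑ) (θ + π) e -
          normalAngle (fun ϑ e' => bandFermiRadius (μ + e') ϑ) θ e = π :=
  lemma71_normalAngle_holds _ _ _ _ (klfs_bgm2003_dispersionHyp he₀ h₁ h₂)

/-- **BGM 2003 Lemma 7.2 (A1.10a) for the Hubbard band**: a point `ρ e⃗_r(θ)` of the s-sector `S_{h,ω}`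
(`h = -n`) has `|ρ - u_μ(θ)| ≤ c γ^h` and `‖θ - θ_{h,ω}‖ ≤ π γ^{h/2}`. [folklore] -/
theorem klfs_bgm2003_lemma72_hubbard :
    ∃ c : ℝ, 0 < c ∧ ∀ (n ω : ℕ), ω < sectorCount n →
      ∀ p ∈ sSector (fun ϑ e' => bandFermiRadius (μ + e') ϑ) e₀ n ω, ∀ ρ θ : ℝ, 0 < ρ → p = ρ • dir θ →
        |ρ - bandFermiRadius (μ + 0) θ| ≤ c * (4 : ℝ) ^ (-(n : ℤ)) ∧
        torusDist (θ - sectorCenter n ω) ≤ π * (2 : ℝ) ^ (-(n : ℤ)) :=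
  lemma72_sectorPolar_holds _ _ _ _ (klfs_bgm2003_dispersionHyp he₀ h₁ h₂)

/-- **BGM 2003 Lemma 7.3 (A1.13)–(A1.14), the sector lemma, for the Hubbard band**: a point of `S_{h,ω}` is
`p⃗_F(θ_{h,ω}) + k₁ n⃗ + k₂ τ⃗` with `|k₁| ≤ cγ^h`, `|k₂| ≤ cγ^{h/2}`, and `|∂ε/∂τ⃗ (p⃗)| ≤ cγ^{h/2}`. [folklore] -/
theorem klfs_bgm2003_lemma73_hubbard :
    ∃ c : ℝ, 0 < c ∧ ∀ (n ω : ℕ), ω < sectorCount n →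
      ∀ p ∈ sSector (fun ϑ e' => bandFermiRadius (μ + e') ϑ) e₀ n ω,
      ∃ k₁ k₂ : ℝ,
        p = fermiPoint (fun ϑ e' => bandFermiRadius (μ + e') ϑ) (sectorCenter n ω) +
              k₁ • unitNormal (fun ϑ e' => bandFermiRadius (μ + e') ϑ) (sectorCenter n ω) 0 +
              k₂ • unitTangent (fun ϑ e' => bandFermiRadius (μ + e') ϑ) (sectorCenter n ω) 0 ∧
        |k₁| ≤ c * (4 : ℝ) ^ (-(n : ℤ)) ∧ |k₂| ≤ c * (2 : ℝ) ^ (-(n : ℤ)) ∧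
        |fderiv ℝ sqDispersion p
            (unitTangent (fun ϑ e' => bandFermiRadius (μ + e') ϑ) (sectorCenter n ω) 0)| ≤
          c * (2 : ℝ) ^ (-(n : ℤ)) :=
  lemma73_sectorBox_holds _ _ _ _ (klfs_bgm2003_dispersionHyp he₀ h₁ h₂)

/-- **BGM 2003 Lemma 7.4 (A1.11) for the Hubbard band**: any solution `(x, θ_⊥)` with `|x| ≤ δ` of the
projection equation `p⃗ = p⃗_F(θ_⊥) + x n⃗(θ_⊥)`, `p⃗ ∈ S_{h,ω}`, has `|x| ≤ cγ^h` and
`‖θ_⊥ - θ_{h,ω}‖ ≤ cγ^{h/2}`. [folklore] -/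
theorem klfs_bgm2003_lemma74_hubbard :
    ∃ c δ : ℝ, 0 < c ∧ 0 < δ ∧ ∀ (n ω : ℕ), ω < sectorCount n →
      ∀ p ∈ sSector (fun ϑ e' => bandFermiRadius (μ + e') ϑ) e₀ n ω,
      ∀ x θ' : ℝ, |x| ≤ δ →
        p = fermiPoint (fun ϑ e' => bandFermiRadius (μ + e') ϑ) θ' +
              x • unitNormal (fun ϑ e' => bandFermiRadius (μ + e') ϑ) θ' 0 →
          |x| ≤ c * (4 : ℝ) ^ (-(n : ℤ)) ∧ torusDist (θ' - sectorCenter n ω) ≤ c * (2 : ℝ) ^ (-(n : ℤ)) :=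
  lemma74_projection_holds _ _ _ _ (klfs_bgm2003_dispersionHyp he₀ h₁ h₂)

/-- **BGM 2003 Lemma 7.5 (s1.16)–(s1.18), the parallelogram lemma, for the Hubbard band**: for every
`c₁ > 0` there are `c₀, c̄₂, η₀ > 0` such that a perturbation `r⃗ = r₁ n⃗(θ̄₁) + r₂ τ⃗(θ̄₁)` of a chord sum
`p⃗_F(θ̄₁) + p⃗_F(θ̄₂)` with `|r₁| ≤ c₁ηφ`, `|r₂| ≤ η ≤ c̄₂φ`, `η ≤ η₀` (`φ` = the pair angle) is again a
chord sum `p⃗_F(θ₁) + p⃗_F(θ₂)` with `|θᵢ - θ̄ᵢ| ≤ c₀η`. [folklore] -/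
theorem klfs_bgm2003_lemma75_hubbard :
    ∀ c₁ : ℝ, 0 < c₁ → ∃ c₀ c₂ η₀ : ℝ, 0 < c₀ ∧ 0 < c₂ ∧ 0 < η₀ ∧
      ∀ θ₁' θ₂' η r₁ r₂ : ℝ, (θ₁', θ₂') ∈ pairChartDomain →
        |r₁| ≤ c₁ * η * pairAngle θ₁' θ₂' → |r₂| ≤ η → η ≤ c₂ * pairAngle θ₁' θ₂' → η ≤ η₀ →
          fermiPoint (fun ϑ e' => bandFermiRadius (μ + e') ϑ) θ₁' +
                fermiPoint (fun ϑ e' => bandFermiRadius (μ + e') ϑ) θ₂' +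
              (r₁ • unitNormal (fun ϑ e' => bandFermiRadius (μ + e') ϑ) θ₁' 0 +
                r₂ • unitTangent (fun ϑ e' => bandFermiRadius (μ + e') ϑ) θ₁' 0)
              ∈ pairRange (fun ϑ e' => bandFermiRadius (μ + e') ϑ) ∧
          ∃ θ₁ θ₂ : ℝ,
            fermiPoint (fun ϑ e' => bandFermiRadius (μ + e') ϑ) θ₁' +
                  fermiPoint (fun ϑ e' => bandFermiRadius (μ + e') ϑ) θ₂' +
                (r₁ • unitNormal (fun ϑ e' => bandFermiRadius (μ + e') ϑ) θ₁' 0 +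
                  r₂ • unitTangent (fun ϑ e' => bandFermiRadius (μ + e') ϑ) θ₁' 0) =
              fermiPoint (fun ϑ e' => bandFermiRadius (μ + e') ϑ) θ₁ +
                fermiPoint (fun ϑ e' => bandFermiRadius (μ + e') ϑ) θ₂ ∧
            |θ₁ - θ₁'| ≤ c₀ * η ∧ |θ₂ - θ₂'| ≤ c₀ * η :=
  lemma75_parallelogram_holds _ _ _ _ (klfs_bgm2003_dispersionHyp he₀ h₁ h₂)

/-! ### §2 BGM 2003 Lemma 3.1 (4.3): the sector counting lemma for the Hubbard band -/

/-- **BGM 2003 Lemma 3.1 (4.3) — the SECTOR COUNTING LEMMA — for the Hubbard band at intermediate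
filling.** On the shell `|ε - μ| ≤ e₀` (`0 < e₀`, `-4 < μ - e₀`, `μ + e₀ < 0`) there is `c > 0` such that
for all scales `h' = -n' ≤ h = -n ≤ 0` (`γ = 4`): for every even number `L ≥ 4` of legs, one leg's fine
sector `ω₁ ∈ O_{h'}` fixed and coarse sectors `ω̃ᵢ ∈ O_h` prescribed for the others, the number of strings of
fine sectors `(ω₁, …, ω_L)` refining them and admitting momenta `k⃗^{(i)} ∈ S_{h',ωᵢ}` with
`Σᵢ k⃗^{(i)} = 0` IN `ℝ²` is at most `c^L γ^{(h-h')(L-3)/2} = c^L 2^{(n'-n)(L-3)}`; for `L = 2` it is at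
most `c`. Composition of t3's `lemma31_sectorCounting_holds` (BGM 2003 §7.4, proved for every
`DispersionHyp` datum) with fs-1's `klfs_bgm2003_dispersionHyp`; BGM's printed range is `μ < -2 - √2`, this
is the whole hole-doped band. Conservation modulo `2πℤ²` is NOT this statement (see the module docstring).
[folklore] -/
theorem klfs_bgm2003_sectorCounting_hubbard :
    ∃ c : ℝ, 0 < c ∧ ∀ (n n' : ℕ), n ≤ n' →
      (∀ (L : ℕ) (i₁ : Fin L) (ω₁ : ℕ) (ωt : Fin L → ℕ), 4 ≤ L → ω₁ < sectorCount n' →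
          (∀ i, ωt i < sectorCount n) →
          (Nat.card (sectorStrings (fun ϑ e' => bandFermiRadius (μ + e') ϑ) e₀ n n' L i₁ ω₁ ωt) : ℝ) ≤
            c ^ L * (2 : ℝ) ^ ((n' - n) * (L - 3))) ∧
      (∀ (i₁ : Fin 2) (ω₁ : ℕ) (ωt : Fin 2 → ℕ), ω₁ < sectorCount n' → (∀ i, ωt i < sectorCount n) →
          (Nat.card (sectorStrings (fun ϑ e' => bandFermiRadius (μ + e') ϑ) e₀ n n' 2 i₁ ω₁ ωt) : ℝ) ≤ c) :=
  lemma31_sectorCounting_holds _ _ _ _ (klfs_bgm2003_dispersionHyp he₀ h₁ h₂)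

/-- **The four-leg case `L = 4`** of BGM 2003 Lemma 3.1 for the Hubbard band: with one fine sector fixed and
three coarse sectors prescribed, the number of compatible fine refinements with momentum conservation in `ℝ²`
is at most `c⁴ 2^{n'-n} = c⁴ γ^{(h-h')/2}` — the isotropic count (3.23) of BGM 2006 at `L = 4`, without
the `|h|` of the umklapp classes (which live modulo `2πℤ²`, `count_pairs_exists`). [folklore] -/
theorem klfs_bgm2003_sectorCounting_four_hubbard :
    ∃ c : ℝ, 0 < c ∧ ∀ (n n' : ℕ), n ≤ n' →
      ∀ (i₁ : Fin 4) (ω₁ : ℕ) (ωt : Fin 4 → ℕ), ω₁ < sectorCount n' → (∀ i, ωt i < sectorCount n) →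
        (Nat.card (sectorStrings (fun ϑ e' => bandFermiRadius (μ + e') ϑ) e₀ n n' 4 i₁ ω₁ ωt) : ℝ) ≤
          c ^ 4 * (2 : ℝ) ^ (n' - n) := by
  obtain ⟨c, hc, h⟩ := klfs_bgm2003_sectorCounting_hubbard he₀ h₁ h₂
  refine ⟨c, hc, fun n n' hnn' i₁ ω₁ ωt hω₁ hωt => ?_⟩
  have h4 := (h n n' hnn').1 4 i₁ ω₁ ωt le_rfl hω₁ hωt
  simpa using h4

end Shell

/-! ### §3 On the programme's windows -/

/-- **On the certified window** `μ ∈ [-0.4267, -0.1798]` (`δ ∈ [0.10, 0.20]`), shell width `e₀ = 0.08`: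
BGM 2003's sector counting Lemma 3.1 holds for the Hubbard band. [folklore] -/
theorem klfs_window_bgm2003_sectorCounting {μ : ℝ} (hμ : μ ∈ Icc (-0.4267 : ℝ) (-0.1798)) :
    ∃ c : ℝ, 0 < c ∧ ∀ (n n' : ℕ), n ≤ n' →
      (∀ (L : ℕ) (i₁ : Fin L) (ω₁ : ℕ) (ωt : Fin L → ℕ), 4 ≤ L → ω₁ < sectorCount n' →
          (∀ i, ωt i < sectorCount n) →
          (Nat.card (sectorStrings (fun ϑ e' => bandFermiRadius (μ + e') ϑ) 0.08 n n' L i₁ ω₁ ωt) : ℝ) ≤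
            c ^ L * (2 : ℝ) ^ ((n' - n) * (L - 3))) ∧
      (∀ (i₁ : Fin 2) (ω₁ : ℕ) (ωt : Fin 2 → ℕ), ω₁ < sectorCount n' → (∀ i, ωt i < sectorCount n) →
          (Nat.card (sectorStrings (fun ϑ e' => bandFermiRadius (μ + e') ϑ) 0.08 n n' 2 i₁ ω₁ ωt) : ℝ) ≤
            c) :=
  klfs_bgm2003_sectorCounting_hubbard (by norm_num) (by linarith [hμ.1]) (by linarith [hμ.2])

/-- **On the certified window**, `e₀ = 0.08`: BGM 2003's sector lemma 7.3 (normal/tangential sector box and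
tangential derivative bound) holds for the Hubbard band. [folklore] -/
theorem klfs_window_bgm2003_lemma73 {μ : ℝ} (hμ : μ ∈ Icc (-0.4267 : ℝ) (-0.1798)) :
    ∃ c : ℝ, 0 < c ∧ ∀ (n ω : ℕ), ω < sectorCount n →
      ∀ p ∈ sSector (fun ϑ e' => bandFermiRadius (μ + e') ϑ) 0.08 n ω,
      ∃ k₁ k₂ : ℝ,
        p = fermiPoint (fun ϑ e' => bandFermiRadius (μ + e') ϑ) (sectorCenter n ω) +
              k₁ • unitNormal (fun ϑ e' => bandFermiRadius (μ + e') ϑ) (sectorCenter n ω) 0 +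
              k₂ • unitTangent (fun ϑ e' => bandFermiRadius (μ + e') ϑ) (sectorCenter n ω) 0 ∧
        |k₁| ≤ c * (4 : ℝ) ^ (-(n : ℤ)) ∧ |k₂| ≤ c * (2 : ℝ) ^ (-(n : ℤ)) ∧
        |fderiv ℝ sqDispersion p
            (unitTangent (fun ϑ e' => bandFermiRadius (μ + e') ϑ) (sectorCenter n ω) 0)| ≤
          c * (2 : ℝ) ^ (-(n : ℤ)) :=
  klfs_bgm2003_lemma73_hubbard (by norm_num) (by linarith [hμ.1]) (by linarith [hμ.2])

/-- **On the analysis window** `μ ∈ [-1, -0.15]` of K1/K3 (`δ ∈ [0.10, 0.35]` via S0), shell width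
`e₀ = 0.07`: BGM 2003's sector counting Lemma 3.1 holds for the Hubbard band. [folklore] -/
theorem klfs_analysisWindow_bgm2003_sectorCounting {μ : ℝ} (hμ : μ ∈ Icc (-1 : ℝ) (-0.15)) :
    ∃ c : ℝ, 0 < c ∧ ∀ (n n' : ℕ), n ≤ n' →
      (∀ (L : ℕ) (i₁ : Fin L) (ω₁ : ℕ) (ωt : Fin L → ℕ), 4 ≤ L → ω₁ < sectorCount n' →
          (∀ i, ωt i < sectorCount n) →
          (Nat.card (sectorStrings (fun ϑ e' => bandFermiRadius (μ + e') ϑ) 0.07 n n' L i₁ ω₁ ωt) : ℝ) ≤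
            c ^ L * (2 : ℝ) ^ ((n' - n) * (L - 3))) ∧
      (∀ (i₁ : Fin 2) (ω₁ : ℕ) (ωt : Fin 2 → ℕ), ω₁ < sectorCount n' → (∀ i, ωt i < sectorCount n) →
          (Nat.card (sectorStrings (fun ϑ e' => bandFermiRadius (μ + e') ϑ) 0.07 n n' 2 i₁ ω₁ ωt) : ℝ) ≤
            c) :=
  klfs_bgm2003_sectorCounting_hubbard (by norm_num) (by linarith [hμ.1]) (by linarith [hμ.2])

/-- **On the analysis window**, `e₀ = 0.07`: BGM 2003's sector lemma 7.3 holds for the Hubbard band. [folklore] -/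
theorem klfs_analysisWindow_bgm2003_lemma73 {μ : ℝ} (hμ : μ ∈ Icc (-1 : ℝ) (-0.15)) :
    ∃ c : ℝ, 0 < c ∧ ∀ (n ω : ℕ), ω < sectorCount n →
      ∀ p ∈ sSector (fun ϑ e' => bandFermiRadius (μ + e') ϑ) 0.07 n ω,
      ∃ k₁ k₂ : ℝ,
        p = fermiPoint (fun ϑ e' => bandFermiRadius (μ + e') ϑ) (sectorCenter n ω) +
              k₁ • unitNormal (fun ϑ e' => bandFermiRadius (μ + e') ϑ) (sectorCenter n ω) 0 +
              k₂ • unitTangent (fun ϑ e' => bandFermiRadius (μ + e') ϑ) (sectorCenter n ω) 0 ∧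
        |k₁| ≤ c * (4 : ℝ) ^ (-(n : ℤ)) ∧ |k₂| ≤ c * (2 : ℝ) ^ (-(n : ℤ)) ∧
        |fderiv ℝ sqDispersion p
            (unitTangent (fun ϑ e' => bandFermiRadius (μ + e') ϑ) (sectorCenter n ω) 0)| ≤
          c * (2 : ℝ) ^ (-(n : ℤ)) :=
  klfs_bgm2003_lemma73_hubbard (by norm_num) (by linarith [hμ.1]) (by linarith [hμ.2])

end Summit.HubbardSuperconductivity.HubbardSuperconductivity.Theorems

end
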